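import Mathlib

/-!
# SoloBlind — the first exceptional Koblitz–Ogus class (level 33)

Finite certificates behind `paper/weil-transport.md` §6 of the solo-blind programme on the
Kontsevich–Zagier conjecture.

A vector `e : {1,…,N-1} → ℤ` encodes the Γ-monomial `∏ Γ(k/N)^{e k}`.  The Koblitz–Ogus sums are
`S_u(e) = Σ_k e_k ⟨uk⟩_N` for units `u mod N`; `e` is a *Koblitz–Ogus unit of π-weight 0* when
`S_u(e) = 0` for every unit `u` (then the monomial is an algebraic number, Koblitz–Ogus/Deligne).

The "one-dimensional" sublattice is generated by
* reflections `e_k + e_{N-k}`,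
* Gauss multiplication units `Σ_{j<d} e_{k+jN/d} - e_{dk}` (`d ∣ N`),
* two-term Beta units `β(a,b) - β(a',b')` for Fermat triples of equal CM type, where
  `β(a,b) = e_a + e_b - e_{a+b}` and the CM type of `(a,b)` is `{u : ⟨ua⟩ + ⟨ub⟩ + ⟨u(-a-b)⟩ = N}`.

At `N = 33` the vector `v33 = -e₁ + e₂ - e₄ + e₈ + e₁₁ - e₁₆`, i.e.
`Γ(2/33)Γ(8/33)Γ(11/33) / (Γ(1/33)Γ(4/33)Γ(16/33))`, is a Koblitz–Ogus unit of π-weight 0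
(`das33_koUnit`) which is NOT in the one-dimensional sublattice.  The separating functional is the
parity of the number of `Γ(k/3)`-factors, `w(e) = e₁₁ + e₂₂ (mod 2)`:
* `das33_refl_even`, `das33_mult_even`: `w` is even on every reflection and multiplication generator;
* `das33_twoTerm_even`: Fermat triples of level 33 with equal CM type agree on whether `11` divides
  one of their entries — equivalently `w` is even on every two-term unit;
* `das33_v_odd`: `w(v33)` is odd.
Hence `v33 ∉ ⟨reflections, multiplication, two-term⟩` (an index-2 phenomenon: `2·v33` does lie in
the sublattice).  In the dictionary with Hodge classes on Fermat varieties `v33` is a semi-standard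
class on the Fermat fourfold of degree 33.
-/

namespace Summit.KontsevichZagierPeriods.KontsevichZagierPeriods.Theorems
namespace SoloBlind

/-- A Γ-monomial of level `N` as a list of (index, exponent) pairs; indices are read mod `N`. -/
abbrev GammaMonomial := List (ℕ × ℤ)

/-- Koblitz–Ogus sum `S_u(e) = Σ e_k ⟨u k⟩_N`. -/
def koSumOf (N u : ℕ) (e : GammaMonomial) : ℤ :=
  e.foldl (fun acc kc => acc + kc.2 * (((u * kc.1) % N : ℕ) : ℤ)) 0

/-- The units mod `N` in `1 … N-1`. -/
def unitsMod (N : ℕ) : List ℕ := (List.range N).filter fun u => Nat.gcd u N == 1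

/-- `v33 = -e₁ + e₂ - e₄ + e₈ + e₁₁ - e₁₆`. -/
def v33 : GammaMonomial := [(1, -1), (2, 1), (4, -1), (8, 1), (11, 1), (16, -1)]

/-- Parity functional: is `Σ_{q ∣ k, N ∤ k} e_k` even?  (For `N = 33`, `q = 11`: parity of the
number of `Γ(11/33)`, `Γ(22/33)` factors.) -/
def wEven (N q : ℕ) (e : GammaMonomial) : Bool :=
  (e.foldl (fun acc kc => if kc.1 % N != 0 && (kc.1 % N) % q == 0 then acc + kc.2 else acc) 0) % 2 == 0

/-- Reflection generators `e_k + e_{N-k}`, `1 ≤ k ≤ N/2`. -/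
def reflGens (N : ℕ) : List GammaMonomial :=
  ((List.range (N / 2)).map fun i => [(i + 1, (1 : ℤ)), (N - (i + 1), 1)])

/-- Gauss multiplication generators `Σ_{j<d} e_{k + jN/d} - e_{dk}` for `d ∣ N`, `d > 1`, `1 ≤ k < N/d`. -/
def multGens (N : ℕ) : List GammaMonomial :=
  (((List.range (N + 1)).filter fun d => 1 < d && N % d == 0).map fun d =>
    (List.range (N / d - 1)).map fun i =>
      let k := i + 1
      ((List.range d).map fun j => (k + j * (N / d), (1 : ℤ))) ++ [(d * k, (-1 : ℤ))]).flatten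

/-- CM type of the Fermat triple `(a, b, -a-b)` of level `N`, encoded as a natural number
(bitmask over the units). -/
def cmKey (N a b : ℕ) : ℕ :=
  (unitsMod N).foldl (fun acc u =>
    2 * acc + (if (u * a) % N + (u * b) % N + (u * (N * N - a - b)) % N == N then 1 else 0)) 0

/-- Does `q` divide one of `a`, `b`, `a + b` (mod `N`, nonzero)? -/
def divSome (N q a b : ℕ) : Bool :=
  (a % N) % q == 0 || (b % N) % q == 0 || (((a + b) % N) != 0 && ((a + b) % N) % q == 0)

/-- Admissible pairs `1 ≤ a ≤ b ≤ N-1`, `a + b ≢ 0 (mod N)`. -/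
def fermatPairs (N : ℕ) : List (ℕ × ℕ) :=
  ((List.range N).flatMap fun a => (List.range N).filterMap fun b =>
    if 1 ≤ a && a ≤ b && (a + b) % N != 0 then some (a, b) else none)

/-- Table of (CM key, `11 ∣ some entry`) over all admissible pairs of level 33. -/
def cmTable33 : List (ℕ × Bool) := (fermatPairs 33).map fun ab => (cmKey 33 ab.1 ab.2, divSome 33 11 ab.1 ab.2)

set_option maxRecDepth 8192 in
/-- `v33` is a Koblitz–Ogus unit of π-weight 0: all twenty sums `S_u(v33)` vanish. -/
theorem das33_koUnit : ((unitsMod 33).all fun u => koSumOf 33 u v33 == 0) = true := by decide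

set_option maxRecDepth 8192 in
/-- `w` is even on the 16 reflection generators of level 33. -/
theorem das33_refl_even : ((reflGens 33).all (wEven 33 11)) = true := by decide

set_option maxRecDepth 8192 in
/-- `w` is even on the multiplication generators of level 33 (`d = 3, 11, 33`). -/
theorem das33_mult_even : ((multGens 33).all (wEven 33 11)) = true := by decide

set_option maxRecDepth 8192 in
/-- `w(v33)` is odd. -/
theorem das33_v_odd : wEven 33 11 v33 = false := by decide

set_option maxRecDepth 65536 in
set_option maxHeartbeats 4000000 in
/-- Fermat triples of level 33 with equal CM type agree on whether 11 divides one of their entries;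
equivalently `w` is even on every two-term Beta unit `β(a,b) - β(a',b')`. -/
theorem das33_twoTerm_even :
    (cmTable33.all fun x => cmTable33.all fun y => x.1 != y.1 || x.2 == y.2) = true := by
  decide +kernel

end SoloBlind
end Summit.KontsevichZagierPeriods.KontsevichZagierPeriods.Theorems
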